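import Literature.NumberTheory.Automorphic.BCDTTheoremBWildAtThree
import Literature.NumberTheory.GaloisRepresentations.ModNCyclotomicCharacter
import HarnessLib

/-!
# BCDT Theorem 2.2.1, cases 2–6: the shape of `ρ̄` at `3` in the wild case, with the cyclotomic determinant

Topic `NumberTheory/Automorphic`; a theorems-only companion (no definitions, no named facts) of
`Literature.NumberTheory.Automorphic.BCDTTheoremBWildAtThree`, landed by the tenured seat of the
named fact `Literature.NumberTheory.Automorphic.BCDT.theoremB` (Breuil–Conrad–Diamond–Taylor 2001,
Thm. B = Thm. 2.2.1) as a further bottom-up step INSIDE the one remaining opaque piece of its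
printed proof, the wild case `exists_isTorsionGaloisRep_and_isModular_of_not_isTamelyRamifiedAbove`
(BCDT §2.2, cases 2–6).

C. Breuil, B. Conrad, F. Diamond, R. Taylor, J. Amer. Math. Soc. 14 (2001) [BCDTJAMS2001], proof
of Theorem 2.2.1 (p. 860), for `ρ̄ : G_ℚ → GL₂(𝔽₅)` absolutely irreducible **with cyclotomic
determinant**: *"Then up to equivalence and twisting by a quadratic character, one of the
following possibilities can be attained. 1. `ρ̄` is tamely ramified at `3`. 2. `ρ̄|_{G₃}` is given
by the character `ℚ₃^× → 𝔽₅(τ)^×` determined by `3 ↦ τⁱ(τ - τ⁻¹)`, `-1 ↦ 1`, `4 ↦ τ` … 3.–6. … To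
see that one of these cases can be attained, use the following facts … • A subgroup of `GL₂(𝔽₅)`
with a non-trivial normal subgroup of `3`-power order is, up to conjugation, contained in the
normaliser of `𝔽₅(τ)^×`. • The intersection of `SL₂(𝔽₅)` with the normaliser of `τ` in `GL₂(𝔽₅)`
is generated by `τ` and an element `σ` such that `σ² = -1` and `στσ⁻¹ = τ⁻¹`. • If
`α ∈ 𝔽₅(τ)^×`, `det α = 3`, and `σασ⁻¹ = -α`, then `α = ±(τ - τ⁻¹)`."*

`BCDTTheoremBWildAtThree` applied the first bullet: for `ρ̄` NOT tamely ramified above `3`, after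
a conjugation `ρ̄ˣ = xρ̄x⁻¹`, `ρ̄ˣ(D_𝔓) ≤ N(𝔽₅(τ)^×)` and `ρ̄ˣ(P) = ⟨τ⟩` for the wild ramification
groups `P = Γ_ℚ^u(𝔓)`, `u > 0` small.  This file adds the hypothesis of Theorem 2.2.1 that BCDT's
case list silently uses at `3` — **the determinant is the mod-`5` cyclotomic character `χ̄₅`** —
and applies the second bullet (and the norm computation behind the third):

* `Rat.modNCyclotomicCharacter_eq_one_of_mem_inertia`, `Rat.modNCyclotomicCharacter_of_isArithFrobAt`
  (and their `N = 5`, `p = 3` instances) — over `ℚ`, `χ_N` is trivial on the inertia groups above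
  `p ∤ N` and is `p` at every arithmetic Frobenius above `p` (the tree's
  `modNCyclotomicCharacter_eq_one_of_mem_inertia` / `…_eq_residueCard_of_isArithFrobAt` of
  `ModNCyclotomicCharacter`, specialised: `N v = p`, `N ∉ 𝔓`);
* `GL2F5OrderThree.mem_closure_tau_sigma_of_mem_normalizer_of_det_eq_one` — the second bullet
  applied: an element of determinant `1` normalising `𝔽₅(τ)^×` lies in `⟨τ, σ⟩` (order `12`);
  with `N(𝔽₅(τ)^×) ≤ N(⟨τ⟩)` (`mem_normalizer_zpowers_tau_of_mem_normalizer_unitsF5Tau`);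
* `GL2F5OrderThree.eq_of_zpowers_tau_le_of_le_closure` — the subgroups `S` with
  `⟨τ⟩ ≤ S ≤ ⟨τ, σ⟩` are `⟨τ⟩`, `⟨τ, -1⟩ = μ₆ ⊂ 𝔽₅(τ)^×` and `⟨τ, σ⟩ ⊄ 𝔽₅(τ)^×`;
* `GL2F5OrderThree.exists_eq_tau_pow_mul_of_mem_unitsF5Tau_of_det_eq_three` — the elements of
  `𝔽₅(τ)^×` of determinant (norm) `3` are the six `±τⁱ(τ - τ⁻¹)`;
  `GL2F5OrderThree.val_sq_of_mem_normalizer_of_not_mem` — for `g ∈ N(𝔽₅(τ)^×) ∖ 𝔽₅(τ)^×`,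
  `g² = -det g` (`g = σc`, `σ⁻¹cσ·c = N(c)`: conjugation by `σ` is the Frobenius of `𝔽₂₅/𝔽₅`);
* **`BCDT.exists_conj_of_not_isTamelyRamifiedAbove_three_of_det`** — for `ρ̄` continuous with
  `det ρ̄ = χ̄₅` and not tamely ramified above `3`: at some `𝔓 ∣ 3`, after conjugation,
  `ρ̄ˣ(D_𝔓) ≤ N(𝔽₅(τ)^×)`; `det ρ̄ = 1` on `I_𝔓` and `ρ̄ˣ(I_𝔓) ≤ ⟨τ, σ⟩`; `det ρ̄ˣ(φ) = 3` at every
  arithmetic Frobenius `φ ∈ D_𝔓`; `ρ̄ˣ(Γ^u) ≤ ⟨τ⟩` for `u > 0` with equality for some `u`; hence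
  `⟨τ⟩ ≤ ρ̄ˣ(I_𝔓) ≤ ⟨τ, σ⟩` and `ρ̄ˣ(I_𝔓) ∈ {⟨τ⟩, ⟨τ, -1⟩, ⟨τ, σ⟩}`;
* `BCDT.exists_conj_relIndex_of_not_isTamelyRamifiedAbove_three_of_det` — the preimage `H` of the
  Cartan subgroup `𝔽₅(τ)^×` meets `D_𝔓` with index `1` (case 2) or `2` (cases 3–6, `H ∩ D_𝔓 = G_M`
  for a quadratic `M/ℚ₃`), and `I_𝔓 ≤ H` (so `M/ℚ₃` is unramified: case 3) unless
  `ρ̄ˣ(I_𝔓) = ⟨τ, σ⟩`, which happens iff `I_𝔓 ≰ H` (`M/ℚ₃` ramified: cases 4–6);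
* `BCDT.exists_conj_frobenius_of_not_isTamelyRamifiedAbove_three_of_det` — at an arithmetic
  Frobenius `φ`: `ρ̄ˣ(φ) = ±τⁱ(τ - τ⁻¹)` if `ρ̄ˣ(φ) ∈ 𝔽₅(τ)^×` (BCDT's "`3 ↦ τⁱ(τ - τ⁻¹)`", the sign
  being the quadratic twist), and `ρ̄ˣ(φ)² = -3 = 2` (scalar) if `ρ̄ˣ(φ) ∉ 𝔽₅(τ)^×`.

What is NOT done here: the identification of these Galois-side data with the printed characters
of `ℚ₃^×`, `ℚ₃(√-1)^×`, `ℚ₃(√±3)^×` (local class field theory, including the match of the upper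
ramification breaks with the unit filtration), the relation `φσφ⁻¹ ≡ σ³` on tame inertia (which,
with the third bullet, pins the Frobenius in cases 4–6), and the quadratic-twist normalisation
itself (modularity of `ρ̄` is twist-invariant; not yet in the tree for `ModPGaloisRep.IsModular`).

## References

* [BCDTJAMS2001] C. Breuil, B. Conrad, F. Diamond, R. Taylor, J. Amer. Math. Soc. 14 (2001),
  §2.2, proof of Thm. 2.2.1, p. 860 (cases 1–6 and the three bulleted facts).
* [SerreLocalFields1979] J.-P. Serre, *Local Fields*, Ch. IV §§1–3 (ramification groups).
* L. C. Washington, *Introduction to Cyclotomic Fields*, GTM 83, Prop. 2.3, Lemma 2.12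
  (`χ_N` unramified at `p ∤ N`, `χ_N(Frob_p) = p`).

## Design

Pure theorems; `noncomputable section`; namespaces
`Literature.NumberTheory.GaloisRepresentations.GL2F5OrderThree` (finite group theory of
`GL₂(𝔽₅)`, by `decide` certificates on the model `M2` of `GL2F5OrderThree` plus subgroup
calculus), `Literature.NumberTheory.GaloisRepresentations` (the cyclotomic character of `Γ_ℚ` at
`p ∤ N`) and `Literature.NumberTheory.Automorphic.BCDT` (the three assemblies).  No instances, no
`sorry`, no definitions, no named facts.  Axioms of every theorem: `propext`, `Classical.choice`,
`Quot.sound`.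
-/

noncomputable section

open scoped NumberField Pointwise
open IsDedekindDomain

namespace Literature.NumberTheory.GaloisRepresentations.GL2F5OrderThree

/-! ## More arithmetic in `𝔽₅(τ) ⊂ M₂(𝔽₅)`: certificates on the model `M2` -/

namespace M2

/-- **Conjugation by `σ` is the Frobenius of `𝔽₅(τ)` and `ᾱ α = N(α) = det α`**: for
`α = a + cτ`, `((-σ) α σ) α = σ⁻¹ α σ α = det α · 1`. [folklore] -/
theorem norm_cert : ∀ a c : ZMod 5,
    mul (mul (mul (neg sigma) (lin a c)) sigma) (lin a c) = ⟨det (lin a c), 0, 0, det (lin a c)⟩ := by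
  decide

/-- **The six elements of `𝔽₅(τ)` of norm (determinant) `3`**: `±(τ - τ⁻¹)`, `±τ(τ - τ⁻¹)`,
`±τ²(τ - τ⁻¹)`, i.e. `a + cτ` with `(a, c) ∈ {(1,2), (4,3), (3,4), (2,1), (1,4), (4,1)}`. [folklore] -/
theorem det_three_cert : ∀ a c : ZMod 5, det (lin a c) = 3 →
    (a = 1 ∧ c = 2) ∨ (a = 4 ∧ c = 3) ∨ (a = 3 ∧ c = 4) ∨ (a = 2 ∧ c = 1) ∨
      (a = 1 ∧ c = 4) ∨ (a = 4 ∧ c = 1) := by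
  decide

/-- `τ^i (τ - τ⁻¹)` and their negatives on the model: `τ - τ⁻¹ = 1 + 2τ`, `τ(τ - τ⁻¹) = 3 + 4τ`,
`τ²(τ - τ⁻¹) = 1 + 4τ`. [folklore] -/
theorem tau_pow_mul_lin_one_two_cert :
    mul one (lin 1 2) = lin 1 2 ∧ mul tau (lin 1 2) = lin 3 4 ∧ mul tauSq (lin 1 2) = lin 1 4 ∧
      neg (lin 1 2) = lin 4 3 ∧ neg (lin 3 4) = lin 2 1 ∧ neg (lin 1 4) = lin 4 1 := by
  decide

/-- `-1`, `-τ`, `-τ²` times a suitable power of `τ` is `-1`: `(-τ)·τ² = -1`, `(-τ²)·τ = -1`. [folklore] -/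
theorem neg_mul_tau_pow_cert :
    mul (neg tau) tauSq = neg one ∧ mul (neg tauSq) tau = neg one := by
  decide

end M2

open Matrix

/-! ## `N(𝔽₅(τ)^×) ≤ N(⟨τ⟩)` and the determinant-one part of the normaliser -/

/-- `𝔽₅(τ)^×` normalises (indeed centralises) `⟨τ⟩`. [folklore] -/
theorem unitsF5Tau_le_normalizer_zpowers_tau :
    unitsF5Tau ≤ Subgroup.normalizer (Subgroup.zpowers tau : Set (GL (Fin 2) (ZMod 5))) := by
  intro c hc
  have hc' : c * tau = tau * c := (mem_unitsF5Tau_iff_mul_eq c).mp hc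
  refine mem_normalizer_zpowers_of_conj_mem ?_ ?_
  · rw [hc', mul_inv_cancel_right]; exact Subgroup.mem_zpowers _
  · rw [mul_assoc, ← hc', inv_mul_cancel_left]; exact Subgroup.mem_zpowers _

/-- `σ` normalises `⟨τ⟩` (`στσ⁻¹ = τ⁻¹`). [folklore] -/
theorem sigma_mem_normalizer_zpowers_tau :
    sigma ∈ Subgroup.normalizer (Subgroup.zpowers tau : Set (GL (Fin 2) (ZMod 5))) := by
  have h : sigma ∈ Subgroup.closure ({tau, sigma} : Set (GL (Fin 2) (ZMod 5))) :=
    Subgroup.subset_closure (by simp)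
  rw [← ker_det_inf_normalizer_zpowers_tau] at h
  exact (Subgroup.mem_inf.mp h).2

/-- **Whoever normalises `𝔽₅(τ)^×` normalises `⟨τ⟩`** (`⟨τ⟩` is the unique subgroup of order `3`
of the cyclic group `𝔽₅(τ)^×`; concretely `N(𝔽₅(τ)^×) = 𝔽₅(τ)^× ∪ σ𝔽₅(τ)^×`, `𝔽₅(τ)^×`
centralises `τ` and `σ` inverts it). [folklore] -/
theorem mem_normalizer_zpowers_tau_of_mem_normalizer_unitsF5Tau {g : GL (Fin 2) (ZMod 5)}
    (hg : g ∈ Subgroup.normalizer (unitsF5Tau : Set (GL (Fin 2) (ZMod 5)))) :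
    g ∈ Subgroup.normalizer (Subgroup.zpowers tau : Set (GL (Fin 2) (ZMod 5))) := by
  rcases mem_or_sigma_inv_mul_mem_of_mem_normalizer_unitsF5Tau hg with h | h
  · exact unitsF5Tau_le_normalizer_zpowers_tau h
  · have hg' : g = sigma * (sigma⁻¹ * g) := by group
    rw [hg']
    exact mul_mem sigma_mem_normalizer_zpowers_tau (unitsF5Tau_le_normalizer_zpowers_tau h)

/-- **BCDT's second fact, applied**: an element of determinant `1` normalising `𝔽₅(τ)^×` lies in
`⟨τ, σ⟩` (the group of order `12` generated by `τ` and `σ`, `σ² = -1`, `στσ⁻¹ = τ⁻¹`).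
[cite: BCDTJAMS2001, §2.2 (proof of Thm. 2.2.1, p. 860, second bullet)] -/
theorem mem_closure_tau_sigma_of_mem_normalizer_of_det_eq_one {g : GL (Fin 2) (ZMod 5)}
    (hg : g ∈ Subgroup.normalizer (unitsF5Tau : Set (GL (Fin 2) (ZMod 5))))
    (hdet : Matrix.GeneralLinearGroup.det g = 1) :
    g ∈ Subgroup.closure ({tau, sigma} : Set (GL (Fin 2) (ZMod 5))) := by
  rw [← ker_det_inf_normalizer_zpowers_tau]
  exact Subgroup.mem_inf.mpr ⟨(MonoidHom.mem_ker).mpr hdet,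
    mem_normalizer_zpowers_tau_of_mem_normalizer_unitsF5Tau hg⟩

/-- Every element of `⟨τ, σ⟩` normalises `𝔽₅(τ)^×` and has determinant `1`. [folklore] -/
theorem mem_normalizer_and_det_eq_one_of_mem_closure {g : GL (Fin 2) (ZMod 5)}
    (hg : g ∈ Subgroup.closure ({tau, sigma} : Set (GL (Fin 2) (ZMod 5)))) :
    g ∈ Subgroup.normalizer (unitsF5Tau : Set (GL (Fin 2) (ZMod 5))) ∧
      Matrix.GeneralLinearGroup.det g = 1 := by
  have h := ker_det_inf_normalizer_zpowers_tau.symm ▸ hg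
  refine ⟨?_, (MonoidHom.mem_ker).mp (Subgroup.mem_inf.mp h).1⟩
  refine (Subgroup.closure_le (K := Subgroup.normalizer (unitsF5Tau : Set (GL (Fin 2) (ZMod 5))))).mpr
    ?_ hg
  intro u hu
  simp only [Set.mem_insert_iff, Set.mem_singleton_iff] at hu
  rcases hu with rfl | rfl
  · exact unitsF5Tau_le_normalizer tau_mem_unitsF5Tau
  · exact sigma_mem_normalizer_unitsF5Tau

/-- **`ᾱ α = N(α)`**: for `c ∈ 𝔽₅(τ)^×`, `(σ⁻¹ c σ) c` is the scalar matrix `det c`. [folklore] -/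
theorem val_sigma_inv_mul_mul_sigma_mul_of_mem_unitsF5Tau {c : GL (Fin 2) (ZMod 5)}
    (hc : c ∈ unitsF5Tau) :
    ((sigma⁻¹ * c * sigma * c : GL (Fin 2) (ZMod 5)) : Matrix (Fin 2) (Fin 2) (ZMod 5)) =
      (Matrix.GeneralLinearGroup.det c : ZMod 5) • (1 : Matrix (Fin 2) (Fin 2) (ZMod 5)) := by
  obtain ⟨a, c', hc'⟩ := (mem_unitsF5Tau_iff_exists_enc_eq c).mp hc
  have hσinv : sigma⁻¹ = -sigma := by
    rw [inv_eq_iff_mul_eq_one, mul_neg, ← pow_two, sigma_sq, neg_neg]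
  have h1 : enc (sigma⁻¹ * c * sigma * c) = ⟨M2.det (M2.lin a c'), 0, 0, M2.det (M2.lin a c')⟩ := by
    rw [enc_mul, enc_mul, enc_mul, hσinv, enc_neg, enc_sigma, hc', ← M2.norm_cert a c']
  have hdet : (Matrix.GeneralLinearGroup.det c : ZMod 5) = M2.det (M2.lin a c') := by
    rw [Matrix.GeneralLinearGroup.val_det_apply, ← toMat_enc c, hc', M2.det_toMat]
  rw [← toMat_enc (sigma⁻¹ * c * sigma * c), h1, hdet]
  ext i j
  fin_cases i <;> fin_cases j <;> simp [M2.toMat]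

/-- **The square of an element of `N(𝔽₅(τ)^×) ∖ 𝔽₅(τ)^×` is the scalar `-det`**: writing
`g = σ c` with `c ∈ 𝔽₅(τ)^×`, `g² = σ² (σ⁻¹ c σ) c = -N(c) = -det g`. [folklore] -/
theorem val_sq_of_mem_normalizer_of_not_mem {g : GL (Fin 2) (ZMod 5)}
    (hg : g ∈ Subgroup.normalizer (unitsF5Tau : Set (GL (Fin 2) (ZMod 5)))) (hg' : g ∉ unitsF5Tau) :
    ((g ^ 2 : GL (Fin 2) (ZMod 5)) : Matrix (Fin 2) (Fin 2) (ZMod 5)) =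
      (-(Matrix.GeneralLinearGroup.det g : ZMod 5)) • (1 : Matrix (Fin 2) (Fin 2) (ZMod 5)) := by
  have hc := (mem_or_sigma_inv_mul_mem_of_mem_normalizer_unitsF5Tau hg).resolve_left hg'
  have hdetc : Matrix.GeneralLinearGroup.det (sigma⁻¹ * g) = Matrix.GeneralLinearGroup.det g := by
    rw [map_mul, map_inv, det_sigma, inv_one, one_mul]
  have hsq : g ^ 2 = sigma ^ 2 * (sigma⁻¹ * (sigma⁻¹ * g) * sigma * (sigma⁻¹ * g)) := by
    rw [pow_two, pow_two]; group
  rw [hsq, Units.val_mul, val_sigma_inv_mul_mul_sigma_mul_of_mem_unitsF5Tau hc, hdetc, sigma_sq,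
    Units.val_neg, Units.val_one, neg_mul, one_mul, neg_smul]

/-- An element of `N(𝔽₅(τ)^×) ∖ 𝔽₅(τ)^×` of determinant `1` has square `-1` (it has order `4`).
[folklore] -/
theorem sq_eq_neg_one_of_mem_normalizer_of_not_mem {g : GL (Fin 2) (ZMod 5)}
    (hg : g ∈ Subgroup.normalizer (unitsF5Tau : Set (GL (Fin 2) (ZMod 5)))) (hg' : g ∉ unitsF5Tau)
    (hdet : Matrix.GeneralLinearGroup.det g = 1) : g ^ 2 = -1 := by
  apply Units.val_injective
  rw [val_sq_of_mem_normalizer_of_not_mem hg hg', hdet, Units.val_one, neg_smul, one_smul,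
    Units.val_neg, Units.val_one]

/-! ## The six elements of `𝔽₅(τ)^×` of norm `3` -/

/-- **The elements of `𝔽₅(τ)^×` of determinant `3` are `±τⁱ(τ - τ⁻¹)`, `i = 0, 1, 2`** (the norm
`𝔽₂₅^× → 𝔽₅^×` is onto with kernel `μ₆ = {±1, ±τ, ±τ²}`; `det (τ - τ⁻¹) = 3`).  In BCDT's case 2
these are the possible images `τⁱ(τ - τ⁻¹)` of a Frobenius (uniformiser `3`), up to the sign
removed by a quadratic twist. [cite: BCDTJAMS2001, §2.2 (proof of Thm. 2.2.1, p. 860, case 2 and third bullet)] -/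
theorem exists_eq_tau_pow_mul_of_mem_unitsF5Tau_of_det_eq_three {α : GL (Fin 2) (ZMod 5)}
    (hα : α ∈ unitsF5Tau) (hdet : (Matrix.GeneralLinearGroup.det α : ZMod 5) = 3) :
    ∃ i : ℕ, i < 3 ∧
      ((α : Matrix (Fin 2) (Fin 2) (ZMod 5)) =
          ((tau ^ i : GL (Fin 2) (ZMod 5)) : Matrix (Fin 2) (Fin 2) (ZMod 5)) *
            ((tau : Matrix (Fin 2) (Fin 2) (ZMod 5)) - ((tau⁻¹ : GL (Fin 2) (ZMod 5)) : Matrix (Fin 2) (Fin 2) (ZMod 5))) ∨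
        (α : Matrix (Fin 2) (Fin 2) (ZMod 5)) =
          -(((tau ^ i : GL (Fin 2) (ZMod 5)) : Matrix (Fin 2) (Fin 2) (ZMod 5)) *
            ((tau : Matrix (Fin 2) (Fin 2) (ZMod 5)) - ((tau⁻¹ : GL (Fin 2) (ZMod 5)) : Matrix (Fin 2) (Fin 2) (ZMod 5))))) := by
  obtain ⟨a, c, hαenc⟩ := (mem_unitsF5Tau_iff_exists_enc_eq α).mp hα
  have hdet' : M2.det (M2.lin a c) = 3 := by
    rw [← hαenc, ← M2.det_toMat, toMat_enc, ← Matrix.GeneralLinearGroup.val_det_apply, hdet]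
  have hαval : (α : Matrix (Fin 2) (Fin 2) (ZMod 5)) = M2.toMat (M2.lin a c) := by
    rw [← hαenc, toMat_enc]
  have hsub : (tau : Matrix (Fin 2) (Fin 2) (ZMod 5)) -
      ((tau⁻¹ : GL (Fin 2) (ZMod 5)) : Matrix (Fin 2) (Fin 2) (ZMod 5)) = M2.toMat (M2.lin 1 2) := by
    rw [val_tau, val_tau_inv]; exact M2.toMat_lin_one_two.1.symm
  have h0 : ((tau ^ 0 : GL (Fin 2) (ZMod 5)) : Matrix (Fin 2) (Fin 2) (ZMod 5)) = M2.toMat M2.one := by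
    rw [pow_zero, Units.val_one, M2.toMat_one]
  have h1 : ((tau ^ 1 : GL (Fin 2) (ZMod 5)) : Matrix (Fin 2) (Fin 2) (ZMod 5)) = M2.toMat M2.tau := by
    rw [pow_one, val_tau]
  have h2 : ((tau ^ 2 : GL (Fin 2) (ZMod 5)) : Matrix (Fin 2) (Fin 2) (ZMod 5)) = M2.toMat M2.tauSq := by
    rw [tau_sq, val_tau_inv]
  obtain ⟨c0, c1, c2, n0, n1, n2⟩ := M2.tau_pow_mul_lin_one_two_cert
  rw [hαval, hsub]
  rcases M2.det_three_cert a c hdet' with ⟨rfl, rfl⟩ | ⟨rfl, rfl⟩ | ⟨rfl, rfl⟩ | ⟨rfl, rfl⟩ |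
      ⟨rfl, rfl⟩ | ⟨rfl, rfl⟩
  · exact ⟨0, by norm_num, Or.inl (by rw [h0, ← M2.toMat_mul, c0])⟩
  · exact ⟨0, by norm_num, Or.inr (by rw [h0, ← M2.toMat_mul, c0, ← M2.toMat_neg, n0])⟩
  · exact ⟨1, by norm_num, Or.inl (by rw [h1, ← M2.toMat_mul, c1])⟩
  · exact ⟨1, by norm_num, Or.inr (by rw [h1, ← M2.toMat_mul, c1, ← M2.toMat_neg, n1])⟩
  · exact ⟨2, by norm_num, Or.inl (by rw [h2, ← M2.toMat_mul, c2])⟩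
  · exact ⟨2, by norm_num, Or.inr (by rw [h2, ← M2.toMat_mul, c2, ← M2.toMat_neg, n2])⟩

/-! ## The subgroups of `⟨τ, σ⟩` containing `τ` -/

/-- The six elements `±1, ±τ, ±τ²` lie in `⟨τ, -1⟩`. [folklore] -/
theorem mem_closure_tau_neg_one_of_mem_six {g : GL (Fin 2) (ZMod 5)}
    (hg : g = 1 ∨ g = -1 ∨ g = tau ∨ g = -tau ∨ g = tau ^ 2 ∨ g = -tau ^ 2) :
    g ∈ Subgroup.closure ({tau, -1} : Set (GL (Fin 2) (ZMod 5))) := by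
  have ht : tau ∈ Subgroup.closure ({tau, -1} : Set (GL (Fin 2) (ZMod 5))) :=
    Subgroup.subset_closure (by simp)
  have hn : (-1 : GL (Fin 2) (ZMod 5)) ∈ Subgroup.closure ({tau, -1} : Set (GL (Fin 2) (ZMod 5))) :=
    Subgroup.subset_closure (by simp)
  have hneg : ∀ u : GL (Fin 2) (ZMod 5), -u = -1 * u := fun u ↦ by rw [neg_mul, one_mul]
  rcases hg with rfl | rfl | rfl | rfl | rfl | rfl
  · exact one_mem _
  · exact hn
  · exact ht
  · rw [hneg tau]; exact mul_mem hn ht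
  · exact pow_mem ht 2
  · rw [hneg (tau ^ 2)]; exact mul_mem hn (pow_mem ht 2)

/-- An element of `⟨τ, σ⟩ ∩ 𝔽₅(τ)^×` is one of `±1, ±τ, ±τ²`. [folklore] -/
theorem mem_six_of_mem_closure_of_mem_unitsF5Tau {g : GL (Fin 2) (ZMod 5)}
    (hg : g ∈ Subgroup.closure ({tau, sigma} : Set (GL (Fin 2) (ZMod 5)))) (hgc : g ∈ unitsF5Tau) :
    g = 1 ∨ g = -1 ∨ g = tau ∨ g = -tau ∨ g = tau ^ 2 ∨ g = -tau ^ 2 :=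
  mem_six_of_mem_unitsF5Tau_of_det_eq_one hgc (mem_normalizer_and_det_eq_one_of_mem_closure hg).2

/-- If `g ∈ ⟨τ, σ⟩ ∩ 𝔽₅(τ)^×` is not a power of `τ` then `-1 ∈ ⟨τ, g⟩`. [folklore] -/
theorem neg_one_mem_closure_of_not_mem_zpowers {g : GL (Fin 2) (ZMod 5)}
    (hg : g ∈ Subgroup.closure ({tau, sigma} : Set (GL (Fin 2) (ZMod 5)))) (hgc : g ∈ unitsF5Tau)
    (hgt : g ∉ Subgroup.zpowers tau) :
    (-1 : GL (Fin 2) (ZMod 5)) ∈ Subgroup.closure ({tau, g} : Set (GL (Fin 2) (ZMod 5))) := by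
  have ht : tau ∈ Subgroup.closure ({tau, g} : Set (GL (Fin 2) (ZMod 5))) :=
    Subgroup.subset_closure (by simp)
  have hg' : g ∈ Subgroup.closure ({tau, g} : Set (GL (Fin 2) (ZMod 5))) :=
    Subgroup.subset_closure (by simp)
  rw [mem_zpowers_iff_of_orderOf_eq_three orderOf_tau] at hgt
  push Not at hgt
  obtain ⟨h1, h2, h3⟩ := hgt
  obtain ⟨m1, m2⟩ := M2.neg_mul_tau_pow_cert
  rcases mem_six_of_mem_closure_of_mem_unitsF5Tau hg hgc with rfl | rfl | rfl | rfl | rfl | rfl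
  · exact absurd rfl h1
  · exact hg'
  · exact absurd rfl h2
  · -- `(-τ) τ² = -1`
    have : (-tau) * tau ^ 2 = -1 := by
      apply enc_injective
      rw [enc_mul, enc_neg, enc_tau, tau_sq, enc_tau_inv, enc_neg, enc_one, m1]
    rw [← this]
    exact mul_mem hg' (pow_mem ht 2)
  · exact absurd rfl h3
  · -- `(-τ²) τ = -1`
    have : (-tau ^ 2) * tau = -1 := by
      apply enc_injective
      rw [enc_mul, enc_neg, tau_sq, enc_tau_inv, enc_tau, enc_neg, enc_one, m2]
    rw [← this]
    exact mul_mem hg' ht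

/-- If `g ∈ ⟨τ, σ⟩ ∖ 𝔽₅(τ)^×` then `σ ∈ ⟨τ, g⟩` (so `⟨τ, g⟩ = ⟨τ, σ⟩`): `g = σ c` with
`c ∈ {±1, ±τ, ±τ²}` and `g² = -1`. [folklore] -/
theorem sigma_mem_closure_of_not_mem_unitsF5Tau {g : GL (Fin 2) (ZMod 5)}
    (hg : g ∈ Subgroup.closure ({tau, sigma} : Set (GL (Fin 2) (ZMod 5)))) (hgc : g ∉ unitsF5Tau) :
    sigma ∈ Subgroup.closure ({tau, g} : Set (GL (Fin 2) (ZMod 5))) := by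
  obtain ⟨hN, hdet⟩ := mem_normalizer_and_det_eq_one_of_mem_closure hg
  have hc := (mem_or_sigma_inv_mul_mem_of_mem_normalizer_unitsF5Tau hN).resolve_left hgc
  have hdetc : Matrix.GeneralLinearGroup.det (sigma⁻¹ * g) = 1 := by
    rw [map_mul, map_inv, det_sigma, inv_one, one_mul, hdet]
  have ht : tau ∈ Subgroup.closure ({tau, g} : Set (GL (Fin 2) (ZMod 5))) :=
    Subgroup.subset_closure (by simp)
  have hg' : g ∈ Subgroup.closure ({tau, g} : Set (GL (Fin 2) (ZMod 5))) :=
    Subgroup.subset_closure (by simp)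
  -- `-1 = g² ∈ ⟨τ, g⟩`, hence `⟨τ, -1⟩ ≤ ⟨τ, g⟩`
  have hneg : (-1 : GL (Fin 2) (ZMod 5)) ∈ Subgroup.closure ({tau, g} : Set (GL (Fin 2) (ZMod 5))) := by
    rw [← sq_eq_neg_one_of_mem_normalizer_of_not_mem hN hgc hdet]
    exact pow_mem hg' 2
  have hle : Subgroup.closure ({tau, -1} : Set (GL (Fin 2) (ZMod 5))) ≤
      Subgroup.closure ({tau, g} : Set (GL (Fin 2) (ZMod 5))) := by
    refine (Subgroup.closure_le _).mpr ?_
    intro u hu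
    simp only [Set.mem_insert_iff, Set.mem_singleton_iff] at hu
    rcases hu with rfl | rfl
    · exact ht
    · exact hneg
  -- `σ = g (σ⁻¹ g)⁻¹` with `σ⁻¹ g ∈ {±1, ±τ, ±τ²} ⊆ ⟨τ, -1⟩`
  have hcmem : sigma⁻¹ * g ∈ Subgroup.closure ({tau, g} : Set (GL (Fin 2) (ZMod 5))) :=
    hle (mem_closure_tau_neg_one_of_mem_six (mem_six_of_mem_unitsF5Tau_of_det_eq_one hc hdetc))
  have : sigma = g * (sigma⁻¹ * g)⁻¹ := by group
  rw [this]
  exact mul_mem hg' (inv_mem hcmem)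

/-- **The subgroups of `⟨τ, σ⟩` containing `τ`** are `⟨τ⟩` (order `3`), `⟨τ, -1⟩ = μ₆` (order `6`,
inside `𝔽₅(τ)^×`) and `⟨τ, σ⟩` itself (order `12`, not inside `𝔽₅(τ)^×`).  For the image `S` of an
inertia group at `3` under a wildly ramified `ρ̄ : G_ℚ → GL₂(𝔽₅)` with cyclotomic determinant
(`⟨τ⟩ = ρ̄(P₃) ≤ S = ρ̄(I₃) ≤ SL₂(𝔽₅) ∩ N(τ) = ⟨τ, σ⟩`) these are: tame inertia acting trivially,
through `-1` (removed by a quadratic twist), or through an element of order `4` outside `𝔽₅(τ)^×`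
(BCDT's cases 4–6, the quadratic field cut out by `ρ̄⁻¹(𝔽₅(τ)^×)` being ramified).
[cite: BCDTJAMS2001, §2.2 (proof of Thm. 2.2.1, p. 860, cases 2–6 and second bullet)] -/
theorem eq_of_zpowers_tau_le_of_le_closure {S : Subgroup (GL (Fin 2) (ZMod 5))}
    (h₁ : Subgroup.zpowers tau ≤ S) (h₂ : S ≤ Subgroup.closure ({tau, sigma} : Set (GL (Fin 2) (ZMod 5)))) :
    S = Subgroup.zpowers tau ∨ S = Subgroup.closure {tau, -1} ∨ S = Subgroup.closure {tau, sigma} := by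
  have htS : tau ∈ S := h₁ (Subgroup.mem_zpowers _)
  by_cases hC : ∃ g ∈ S, g ∉ unitsF5Tau
  · -- some element outside `𝔽₅(τ)^×`: `S = ⟨τ, σ⟩`
    obtain ⟨g, hgS, hgc⟩ := hC
    refine Or.inr (Or.inr (le_antisymm h₂ ?_))
    have hle : Subgroup.closure ({tau, g} : Set (GL (Fin 2) (ZMod 5))) ≤ S := by
      refine (Subgroup.closure_le _).mpr ?_
      intro u hu
      simp only [Set.mem_insert_iff, Set.mem_singleton_iff] at hu
      rcases hu with rfl | rfl
      · exact htS
      · exact hgS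
    refine (Subgroup.closure_le _).mpr ?_
    intro u hu
    simp only [Set.mem_insert_iff, Set.mem_singleton_iff] at hu
    rcases hu with rfl | rfl
    · exact htS
    · exact hle (sigma_mem_closure_of_not_mem_unitsF5Tau (h₂ hgS) hgc)
  · push Not at hC
    by_cases hT : ∃ g ∈ S, g ∉ Subgroup.zpowers tau
    · -- inside `𝔽₅(τ)^×` but not inside `⟨τ⟩`: `S = ⟨τ, -1⟩`
      obtain ⟨g, hgS, hgt⟩ := hT
      refine Or.inr (Or.inl (le_antisymm ?_ ?_))
      · intro u hu
        exact mem_closure_tau_neg_one_of_mem_six (mem_six_of_mem_closure_of_mem_unitsF5Tau (h₂ hu) (hC u hu))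
      · have hneg : (-1 : GL (Fin 2) (ZMod 5)) ∈ S := by
          have hle : Subgroup.closure ({tau, g} : Set (GL (Fin 2) (ZMod 5))) ≤ S := by
            refine (Subgroup.closure_le _).mpr ?_
            intro u hu
            simp only [Set.mem_insert_iff, Set.mem_singleton_iff] at hu
            rcases hu with rfl | rfl
            · exact htS
            · exact hgS
          exact hle (neg_one_mem_closure_of_not_mem_zpowers (h₂ hgS) (hC g hgS) hgt)
        refine (Subgroup.closure_le _).mpr ?_
        intro u hu
        simp only [Set.mem_insert_iff, Set.mem_singleton_iff] at hu
        rcases hu with rfl | rfl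
        · exact htS
        · exact hneg
    · push Not at hT
      exact Or.inl (le_antisymm (fun u hu ↦ hT u hu) h₁)

/-- `⟨τ, -1⟩ ≤ 𝔽₅(τ)^×` while `⟨τ, σ⟩ ≰ 𝔽₅(τ)^×`: the trichotomy
`eq_of_zpowers_tau_le_of_le_closure` separates "inertia maps into the Cartan `𝔽₅(τ)^×`" (first two
cases) from "it does not" (third case). [folklore] -/
theorem closure_tau_neg_one_le_unitsF5Tau :
    Subgroup.closure ({tau, -1} : Set (GL (Fin 2) (ZMod 5))) ≤ unitsF5Tau ∧
      ¬ Subgroup.closure ({tau, sigma} : Set (GL (Fin 2) (ZMod 5))) ≤ unitsF5Tau := by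
  constructor
  · refine (Subgroup.closure_le _).mpr ?_
    intro u hu
    simp only [Set.mem_insert_iff, Set.mem_singleton_iff] at hu
    rcases hu with rfl | rfl
    · exact tau_mem_unitsF5Tau
    · rw [SetLike.mem_coe, mem_unitsF5Tau_iff_mul_eq, neg_one_mul, mul_neg_one]
  · intro h
    exact sigma_not_mem_unitsF5Tau (h (Subgroup.subset_closure (by simp)))

end Literature.NumberTheory.GaloisRepresentations.GL2F5OrderThree

namespace Literature.NumberTheory.GaloisRepresentations

open Field

/-! ## The mod-`N` cyclotomic character of `Γ_ℚ` at a prime `p ∤ N` -/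

/-- The residue field of the place of `ℚ` above the prime `p` has `p` elements. [folklore] -/
theorem Rat.residueCard_eq_of_natCast_mem {p : ℕ} (hp : p.Prime) {v : HeightOneSpectrum (𝓞 ℚ)}
    (hv : (p : 𝓞 ℚ) ∈ v.asIdeal) : v.residueCard = p := by
  have hv' : v = (Rat.HeightOneSpectrum.primesEquiv (R := 𝓞 ℚ)).symm ⟨p, hp⟩ :=
    (EllipticCurves.natCast_mem_asIdeal_iff_eq_primesEquiv_symm v hp).mp hv
  rw [v.residueCard_eq_card_quotient]
  have h : Ideal.span {(Rat.HeightOneSpectrum.natGenerator v : ℤ)} =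
      v.asIdeal.map (Rat.IsIntegralClosure.intEquiv (𝓞 ℚ) : 𝓞 ℚ →+* ℤ) :=
    Rat.HeightOneSpectrum.span_natGenerator v
  rw [Nat.card_congr ((Ideal.quotientEquiv _ _ (Rat.IsIntegralClosure.intEquiv (𝓞 ℚ)) h).trans
    (Int.quotientSpanNatEquivZMod _)).toEquiv, Nat.card_zmod]
  change ((Rat.HeightOneSpectrum.primesEquiv v : Nat.Primes) : ℕ) = p
  rw [hv', Equiv.apply_symm_apply]

/-- For a prime `𝔓` of `ℤ̄` above the rational prime `p ∤ N`: `N ∉ 𝔓`. [folklore] -/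
theorem Rat.natCast_not_mem_of_natCast_mem_of_not_dvd {N p : ℕ} (hp : p.Prime) (hpN : ¬ p ∣ N)
    {v : HeightOneSpectrum (𝓞 ℚ)} (hv : (p : 𝓞 ℚ) ∈ v.asIdeal)
    {𝔓 : Ideal (absIntegers (𝓞 ℚ) ℚ)} (h𝔓 : 𝔓 ∈ v.primesAbove) :
    (N : absIntegers (𝓞 ℚ) ℚ) ∉ 𝔓 := by
  refine Rat.natCast_not_mem_of_mem_primesAbove_of_not_dvd h𝔓 ?_
  rw [(EllipticCurves.natCast_mem_asIdeal_iff_eq_primesEquiv_symm v hp).mp hv, Equiv.apply_symm_apply]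
  exact hpN

/-- **The mod-`N` cyclotomic character of `Γ_ℚ` is unramified at `p ∤ N`**: for a prime `𝔓` of
`ℤ̄` above `p ∤ N` and `σ` in the inertia group `I_𝔓 ≤ Γ_ℚ`, `χ_N(σ) = 1`.
Ref: Washington, *Cyclotomic Fields*, Prop. 2.3; Neukirch, *ANT* I (10.4). [folklore] -/
theorem Rat.modNCyclotomicCharacter_eq_one_of_mem_inertia {N : ℕ} [NeZero N] {p : ℕ} (hp : p.Prime)
    (hpN : ¬ p ∣ N) {v : HeightOneSpectrum (𝓞 ℚ)} (hv : (p : 𝓞 ℚ) ∈ v.asIdeal)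
    {𝔓 : Ideal (absIntegers (𝓞 ℚ) ℚ)} (h𝔓 : 𝔓 ∈ v.primesAbove) {σ : absoluteGaloisGroup ℚ}
    (hσ : σ ∈ 𝔓.inertia (absoluteGaloisGroup ℚ)) : modNCyclotomicCharacter ℚ N σ = 1 := by
  haveI : 𝔓.IsPrime := h𝔓.1
  haveI : NeZero (N : ℚ) := NeZero.charZero
  exact GaloisRepresentations.modNCyclotomicCharacter_eq_one_of_mem_inertia (K := ℚ) (N := N)
    (Rat.natCast_not_mem_of_natCast_mem_of_not_dvd hp hpN hv h𝔓) hσ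

/-- **The mod-`N` cyclotomic character of `Γ_ℚ` at a Frobenius**: for a prime `𝔓` of `ℤ̄` above
`p ∤ N` and an arithmetic Frobenius `φ` at `𝔓` (`φ x ≡ x^p (mod 𝔓)`), `χ_N(φ) = p (mod N)`.
Ref: Washington, *Cyclotomic Fields*, Lemma 2.12 ff.; Neukirch, *ANT* VII §5. [folklore] -/
theorem Rat.modNCyclotomicCharacter_of_isArithFrobAt {N : ℕ} [NeZero N] {p : ℕ} (hp : p.Prime)
    (hpN : ¬ p ∣ N) {v : HeightOneSpectrum (𝓞 ℚ)} (hv : (p : 𝓞 ℚ) ∈ v.asIdeal)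
    {𝔓 : Ideal (absIntegers (𝓞 ℚ) ℚ)} (h𝔓 : 𝔓 ∈ v.primesAbove) {φ : absoluteGaloisGroup ℚ}
    (hφ : IsArithFrobAt (𝓞 ℚ) φ 𝔓) : (modNCyclotomicCharacter ℚ N φ : ZMod N) = p := by
  haveI : NeZero (N : ℚ) := NeZero.charZero
  rw [modNCyclotomicCharacter_eq_residueCard_of_isArithFrobAt (K := ℚ) (N := N) h𝔓
    (Rat.natCast_not_mem_of_natCast_mem_of_not_dvd hp hpN hv h𝔓) hφ,
    Rat.residueCard_eq_of_natCast_mem hp hv]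

/-- The mod-`5` cyclotomic character `χ̄₅` of `Γ_ℚ` is trivial on the inertia groups above `3`.
[folklore] -/
theorem Rat.modPCyclotomicCharacterZMod_five_eq_one_of_mem_inertia_three
    {v : HeightOneSpectrum (𝓞 ℚ)} (hv : ((3 : ℕ) : 𝓞 ℚ) ∈ v.asIdeal)
    {𝔓 : Ideal (absIntegers (𝓞 ℚ) ℚ)} (h𝔓 : 𝔓 ∈ v.primesAbove) {σ : absoluteGaloisGroup ℚ}
    (hσ : σ ∈ 𝔓.inertia (absoluteGaloisGroup ℚ)) : modPCyclotomicCharacterZMod ℚ 5 σ = 1 := by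
  rw [modPCyclotomicCharacterZMod_eq_modNCyclotomicCharacter]
  exact Rat.modNCyclotomicCharacter_eq_one_of_mem_inertia Nat.prime_three (by norm_num) hv h𝔓 hσ

/-- The mod-`5` cyclotomic character `χ̄₅` of `Γ_ℚ` takes the value `3` at every arithmetic
Frobenius above `3`. [folklore] -/
theorem Rat.modPCyclotomicCharacterZMod_five_of_isArithFrobAt_three
    {v : HeightOneSpectrum (𝓞 ℚ)} (hv : ((3 : ℕ) : 𝓞 ℚ) ∈ v.asIdeal)
    {𝔓 : Ideal (absIntegers (𝓞 ℚ) ℚ)} (h𝔓 : 𝔓 ∈ v.primesAbove) {φ : absoluteGaloisGroup ℚ}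
    (hφ : IsArithFrobAt (𝓞 ℚ) φ 𝔓) : (modPCyclotomicCharacterZMod ℚ 5 φ : ZMod 5) = 3 := by
  rw [modPCyclotomicCharacterZMod_eq_modNCyclotomicCharacter,
    Rat.modNCyclotomicCharacter_of_isArithFrobAt Nat.prime_three (by norm_num) hv h𝔓 hφ]
  rfl

end Literature.NumberTheory.GaloisRepresentations

namespace Literature.NumberTheory.Automorphic.BCDT

open Field GaloisRepresentations GaloisRepresentations.GL2F5OrderThree

/-! ## BCDT §2.2, cases 2–6: cyclotomic determinant -/

/-- The determinant is invariant under conjugation. [folklore] -/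
theorem det_conj_eq (x g : GL (Fin 2) (ZMod 5)) :
    Matrix.GeneralLinearGroup.det (x * g * x⁻¹) = Matrix.GeneralLinearGroup.det g := by
  rw [map_mul, map_mul, map_inv, mul_inv_cancel_comm]

/-- **BCDT, proof of Theorem 2.2.1, cases 2–6, with the cyclotomic determinant** (p. 860: the
second bullet *"The intersection of `SL₂(𝔽₅)` with the normaliser of `τ` in `GL₂(𝔽₅)` is generated
by `τ` and an element `σ` such that `σ² = -1` and `στσ⁻¹ = τ⁻¹`"*, applied to the image of
inertia).  Let `ρ̄ : Γ_ℚ → GL₂(𝔽₅)` be continuous with `det ρ̄ = χ̄₅` and NOT tamely ramified above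
`3`.  Then there are a place `v ∣ 3`, a prime `𝔓 ∣ v` of `ℚ̄` and `x ∈ GL₂(𝔽₅)` such that, with
`ρ̄ˣ = x ρ̄ x⁻¹`, `D = D_𝔓`, `I = I_𝔓`:
* `ρ̄ˣ(D) ≤ N(𝔽₅(τ)^×)` (first bullet, `exists_conj_of_not_isTamelyRamifiedAbove_three`);
* on `I` the determinant is `1` (`χ̄₅` is unramified at `3`) and `ρ̄ˣ(I) ≤ ⟨τ, σ⟩ = SL₂(𝔽₅) ∩ N(τ)`
  (second bullet);
* every arithmetic Frobenius `φ` at `𝔓` lies in `D` and `det ρ̄ˣ(φ) = χ̄₅(φ) = 3`;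
* every wild ramification group `Γ_ℚ^u(𝔓)`, `u > 0`, maps into `⟨τ⟩`, and some maps onto `⟨τ⟩`;
* hence `⟨τ⟩ ≤ ρ̄ˣ(I) ≤ ⟨τ, σ⟩`, so that `ρ̄ˣ(I)` is `⟨τ⟩`, `⟨τ, -1⟩ = μ₆ ⊂ 𝔽₅(τ)^×` or `⟨τ, σ⟩`
  (`GL2F5OrderThree.eq_of_zpowers_tau_le_of_le_closure`): in the first two cases inertia maps into
  the Cartan subgroup `𝔽₅(τ)^×` (BCDT's cases 2–3, the values `-1 ↦ ±1` on tame inertia being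
  normalised by the quadratic twist), in the third it does not (cases 4–6, `ρ̄⁻¹(𝔽₅(τ)^×)` cutting
  out a ramified quadratic extension of `ℚ₃`).
The identification of these data with characters of `ℚ₃^×`, `ℚ₃(√-1)^×`, `ℚ₃(√±3)^×` (the printed
list 2–6) is local class field theory and is not done here.
[cite: BCDTJAMS2001, §2.2 (proof of Thm. 2.2.1, p. 860: cases 2–6, first and second bullets)] -/
theorem exists_conj_of_not_isTamelyRamifiedAbove_three_of_det (ρ : ModPGaloisRep ℚ (ZMod 5) 2)
    (hdet : ∀ σ : absoluteGaloisGroup ℚ,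
      Matrix.GeneralLinearGroup.det (ρ σ) = modPCyclotomicCharacterZMod ℚ 5 σ)
    (hwild : ¬ ρ.IsTamelyRamifiedAbove 3) :
    ∃ v : HeightOneSpectrum (𝓞 ℚ), ((3 : ℕ) : 𝓞 ℚ) ∈ v.asIdeal ∧ ∃ 𝔓 ∈ v.primesAbove,
      ∃ x : GL (Fin 2) (ZMod 5),
        (∀ σ ∈ 𝔓.decompositionSubgroup (absoluteGaloisGroup ℚ),
            x * ρ σ * x⁻¹ ∈ Subgroup.normalizer (unitsF5Tau : Set (GL (Fin 2) (ZMod 5)))) ∧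
        (∀ σ ∈ 𝔓.inertia (absoluteGaloisGroup ℚ),
            Matrix.GeneralLinearGroup.det (ρ σ) = 1 ∧
              x * ρ σ * x⁻¹ ∈ Subgroup.closure ({tau, sigma} : Set (GL (Fin 2) (ZMod 5)))) ∧
        (∀ φ : absoluteGaloisGroup ℚ, IsArithFrobAt (𝓞 ℚ) φ 𝔓 →
            φ ∈ 𝔓.decompositionSubgroup (absoluteGaloisGroup ℚ) ∧
              (Matrix.GeneralLinearGroup.det (x * ρ φ * x⁻¹) : ZMod 5) = 3) ∧
        (∀ u : ℝ, 0 < u → ∀ σ ∈ absUpperRamificationSubgroup (𝓞 ℚ) 𝔓 u,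
            x * ρ σ * x⁻¹ ∈ Subgroup.zpowers tau) ∧
        (∃ u : ℝ, 0 < u ∧
          (absUpperRamificationSubgroup (𝓞 ℚ) 𝔓 u).map
              ((MulAut.conj x).toMonoidHom.comp ρ.toMonoidHom) = Subgroup.zpowers tau) ∧
        Subgroup.zpowers tau ≤
            (𝔓.inertia (absoluteGaloisGroup ℚ)).map ((MulAut.conj x).toMonoidHom.comp ρ.toMonoidHom) ∧
        (𝔓.inertia (absoluteGaloisGroup ℚ)).map ((MulAut.conj x).toMonoidHom.comp ρ.toMonoidHom) ≤
            Subgroup.closure {tau, sigma} ∧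
        ((𝔓.inertia (absoluteGaloisGroup ℚ)).map ((MulAut.conj x).toMonoidHom.comp ρ.toMonoidHom) =
              Subgroup.zpowers tau ∨
          (𝔓.inertia (absoluteGaloisGroup ℚ)).map ((MulAut.conj x).toMonoidHom.comp ρ.toMonoidHom) =
              Subgroup.closure {tau, -1} ∨
          (𝔓.inertia (absoluteGaloisGroup ℚ)).map ((MulAut.conj x).toMonoidHom.comp ρ.toMonoidHom) =
              Subgroup.closure {tau, sigma}) := by
  obtain ⟨v, hv, 𝔓, h𝔓, x, hN, hwildle, u₀, hu₀, hmap⟩ :=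
    exists_conj_of_not_isTamelyRamifiedAbove_three ρ hwild
  haveI : 𝔓.IsPrime := h𝔓.1
  -- inertia: determinant `1`, hence into `⟨τ, σ⟩`
  have hI : ∀ σ ∈ 𝔓.inertia (absoluteGaloisGroup ℚ),
      Matrix.GeneralLinearGroup.det (ρ σ) = 1 ∧
        x * ρ σ * x⁻¹ ∈ Subgroup.closure ({tau, sigma} : Set (GL (Fin 2) (ZMod 5))) := by
    intro σ hσ
    have hdet1 : Matrix.GeneralLinearGroup.det (ρ σ) = 1 := by
      rw [hdet]
      exact Rat.modPCyclotomicCharacterZMod_five_eq_one_of_mem_inertia_three hv h𝔓 hσ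
    refine ⟨hdet1, mem_closure_tau_sigma_of_mem_normalizer_of_det_eq_one
      (hN σ (Ideal.inertia_le_decompositionSubgroup _ _ hσ)) ?_⟩
    rw [det_conj_eq, hdet1]
  -- the image of inertia
  have hS₁ : Subgroup.zpowers tau ≤
      (𝔓.inertia (absoluteGaloisGroup ℚ)).map ((MulAut.conj x).toMonoidHom.comp ρ.toMonoidHom) := by
    rw [← hmap]
    exact Subgroup.map_mono (absUpperRamificationSubgroup_le_inertia_holds (𝓞 ℚ) 𝔓 u₀ (K := ℚ))
  have hS₂ : (𝔓.inertia (absoluteGaloisGroup ℚ)).map ((MulAut.conj x).toMonoidHom.comp ρ.toMonoidHom) ≤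
      Subgroup.closure {tau, sigma} := by
    rintro _ ⟨σ, hσ, rfl⟩
    exact (hI σ hσ).2
  refine ⟨v, hv, 𝔓, h𝔓, x, hN, hI, fun φ hφ ↦ ⟨hφ.mem_stabilizer, ?_⟩, hwildle, ⟨u₀, hu₀, hmap⟩,
    hS₁, hS₂, eq_of_zpowers_tau_le_of_le_closure hS₁ hS₂⟩
  rw [det_conj_eq, hdet]
  exact Rat.modPCyclotomicCharacterZMod_five_of_isArithFrobAt_three hv h𝔓 hφ

/-- **The index-`2` subgroup `H = ρ̄⁻¹(𝔽₅(τ)^×)` and the unramified/ramified split** (BCDT's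
case 2 versus 3 versus 4–6).  With `v, 𝔓, x, ρ̄ˣ` as in
`exists_conj_of_not_isTamelyRamifiedAbove_three_of_det` and `H` the preimage of the Cartan
subgroup `𝔽₅(τ)^×` under `ρ̄ˣ`: `H ∩ D_𝔓` has index `1` or `2` in `D_𝔓` (case 2: `ρ̄ˣ(D_𝔓) ≤ 𝔽₅(τ)^×`;
cases 3–6: `H ∩ D_𝔓 = G_M` for a quadratic `M/ℚ₃`), and `I_𝔓 ≤ H` (i.e. `M/ℚ₃` unramified,
`M = ℚ₃(√-1)`, case 3 — or case 2) unless `ρ̄ˣ(I_𝔓) = ⟨τ, σ⟩`, which happens exactly when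
`I_𝔓 ≰ H` (`M/ℚ₃` ramified, `M = ℚ₃(√±3)`, cases 4–6).
[cite: BCDTJAMS2001, §2.2 (proof of Thm. 2.2.1, p. 860, cases 2–6)] -/
theorem exists_conj_relIndex_of_not_isTamelyRamifiedAbove_three_of_det (ρ : ModPGaloisRep ℚ (ZMod 5) 2)
    (hdet : ∀ σ : absoluteGaloisGroup ℚ,
      Matrix.GeneralLinearGroup.det (ρ σ) = modPCyclotomicCharacterZMod ℚ 5 σ)
    (hwild : ¬ ρ.IsTamelyRamifiedAbove 3) :
    ∃ v : HeightOneSpectrum (𝓞 ℚ), ((3 : ℕ) : 𝓞 ℚ) ∈ v.asIdeal ∧ ∃ 𝔓 ∈ v.primesAbove,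
      ∃ x : GL (Fin 2) (ZMod 5),
        (∀ σ ∈ 𝔓.decompositionSubgroup (absoluteGaloisGroup ℚ),
            x * ρ σ * x⁻¹ ∈ Subgroup.normalizer (unitsF5Tau : Set (GL (Fin 2) (ZMod 5)))) ∧
        (∃ u : ℝ, 0 < u ∧
          (absUpperRamificationSubgroup (𝓞 ℚ) 𝔓 u).map
              ((MulAut.conj x).toMonoidHom.comp ρ.toMonoidHom) = Subgroup.zpowers tau) ∧
        ((unitsF5Tau.comap ((MulAut.conj x).toMonoidHom.comp ρ.toMonoidHom)).relIndex
              (𝔓.decompositionSubgroup (absoluteGaloisGroup ℚ)) = 1 ∨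
          (unitsF5Tau.comap ((MulAut.conj x).toMonoidHom.comp ρ.toMonoidHom)).relIndex
              (𝔓.decompositionSubgroup (absoluteGaloisGroup ℚ)) = 2) ∧
        (𝔓.inertia (absoluteGaloisGroup ℚ) ≤ unitsF5Tau.comap ((MulAut.conj x).toMonoidHom.comp ρ.toMonoidHom) ∨
          (𝔓.inertia (absoluteGaloisGroup ℚ)).map ((MulAut.conj x).toMonoidHom.comp ρ.toMonoidHom) =
              Subgroup.closure {tau, sigma}) ∧
        ((𝔓.inertia (absoluteGaloisGroup ℚ)).map ((MulAut.conj x).toMonoidHom.comp ρ.toMonoidHom) =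
              Subgroup.closure {tau, sigma} ↔
          ¬ 𝔓.inertia (absoluteGaloisGroup ℚ) ≤
              unitsF5Tau.comap ((MulAut.conj x).toMonoidHom.comp ρ.toMonoidHom)) := by
  obtain ⟨v, hv, 𝔓, h𝔓, x, hN, hI, -, -, hwild', hS₁, hS₂, htri⟩ :=
    exists_conj_of_not_isTamelyRamifiedAbove_three_of_det ρ hdet hwild
  set f := (MulAut.conj x).toMonoidHom.comp ρ.toMonoidHom with hf
  have hfapply : ∀ σ, f σ = x * ρ σ * x⁻¹ := fun σ ↦ rfl
  set D := 𝔓.decompositionSubgroup (absoluteGaloisGroup ℚ) with hD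
  set I := 𝔓.inertia (absoluteGaloisGroup ℚ) with hIdef
  set H := unitsF5Tau.comap f with hH
  -- `I ≤ H ↔ f(I) ≤ 𝔽₅(τ)^× ↔ f(I) ≠ ⟨τ, σ⟩`
  have hiff : I.map f = Subgroup.closure {tau, sigma} ↔ ¬ I ≤ H := by
    rw [hH, ← Subgroup.map_le_iff_le_comap]
    constructor
    · intro h hle
      rw [h] at hle
      exact closure_tau_neg_one_le_unitsF5Tau.2 hle
    · intro h
      rcases htri with h' | h' | h'
      · exact absurd (h'.le.trans zpowers_tau_le_unitsF5Tau) h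
      · exact absurd (h'.le.trans closure_tau_neg_one_le_unitsF5Tau.1) h
      · exact h'
  refine ⟨v, hv, 𝔓, h𝔓, x, hN, hwild', ?_, ?_, hiff⟩
  · -- index `1` or `2`
    by_cases hle : D ≤ H
    · exact Or.inl (Subgroup.relIndex_eq_one.mpr hle)
    · right
      rw [Subgroup.relIndex_eq_two_iff_exists_notMem_and]
      obtain ⟨a, haD, haH⟩ := Set.not_subset.mp hle
      refine ⟨a, haD, haH, fun b hbD ↦ ?_⟩
      by_cases hbH : b ∈ H
      · exact Or.inr hbH
      · left
        change x * ρ (b * a) * x⁻¹ ∈ unitsF5Tau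
        rw [map_mul]
        have e : x * (ρ b * ρ a) * x⁻¹ = x * ρ b * x⁻¹ * (x * ρ a * x⁻¹) := by group
        rw [e]
        exact mul_mem_unitsF5Tau_of_not_mem_of_not_mem (hN b hbD) (hN a haD) hbH haH
  · -- `I ≤ H` or `f(I) = ⟨τ, σ⟩`
    by_cases h : I ≤ H
    · exact Or.inl h
    · exact Or.inr (hiff.mpr h)

/-- **Frobenius at `3` in the wild case** (BCDT's case list, the values at the uniformiser).
With `v, 𝔓, x, ρ̄ˣ` as in `exists_conj_of_not_isTamelyRamifiedAbove_three_of_det` and `φ` any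
arithmetic Frobenius at `𝔓`: `det ρ̄ˣ(φ) = 3`, so
* if `ρ̄ˣ(φ) ∈ 𝔽₅(τ)^×` (always in case 2; in cases 4–6 for the Frobenius elements lying in
  `H = ρ̄⁻¹(𝔽₅(τ)^×)`), then `ρ̄ˣ(φ) = ±τⁱ(τ - τ⁻¹)` for some `i ∈ {0, 1, 2}` — the six elements of
  `𝔽₅(τ)^×` of norm `3` (BCDT: "`3 ↦ τⁱ(τ - τ⁻¹)`", the sign being a quadratic twist);
* if `ρ̄ˣ(φ) ∉ 𝔽₅(τ)^×` (always in case 3), then `ρ̄ˣ(φ)² = ρ̄ˣ(φ²)` is the scalar `-3 = 2`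
  (`ρ̄ˣ(φ) = σc`, `(σc)² = σ²·c̄c = -N(c) = -det ρ̄ˣ(φ)`).
[cite: BCDTJAMS2001, §2.2 (proof of Thm. 2.2.1, p. 860, cases 2–6 and third bullet)] -/
theorem exists_conj_frobenius_of_not_isTamelyRamifiedAbove_three_of_det (ρ : ModPGaloisRep ℚ (ZMod 5) 2)
    (hdet : ∀ σ : absoluteGaloisGroup ℚ,
      Matrix.GeneralLinearGroup.det (ρ σ) = modPCyclotomicCharacterZMod ℚ 5 σ)
    (hwild : ¬ ρ.IsTamelyRamifiedAbove 3) :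
    ∃ v : HeightOneSpectrum (𝓞 ℚ), ((3 : ℕ) : 𝓞 ℚ) ∈ v.asIdeal ∧ ∃ 𝔓 ∈ v.primesAbove,
      ∃ x : GL (Fin 2) (ZMod 5),
        (∀ σ ∈ 𝔓.decompositionSubgroup (absoluteGaloisGroup ℚ),
            x * ρ σ * x⁻¹ ∈ Subgroup.normalizer (unitsF5Tau : Set (GL (Fin 2) (ZMod 5)))) ∧
        (∃ u : ℝ, 0 < u ∧
          (absUpperRamificationSubgroup (𝓞 ℚ) 𝔓 u).map
              ((MulAut.conj x).toMonoidHom.comp ρ.toMonoidHom) = Subgroup.zpowers tau) ∧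
        ∀ φ : absoluteGaloisGroup ℚ, IsArithFrobAt (𝓞 ℚ) φ 𝔓 →
          (Matrix.GeneralLinearGroup.det (x * ρ φ * x⁻¹) : ZMod 5) = 3 ∧
          (x * ρ φ * x⁻¹ ∈ unitsF5Tau →
            ∃ i : ℕ, i < 3 ∧
              (((x * ρ φ * x⁻¹ : GL (Fin 2) (ZMod 5)) : Matrix (Fin 2) (Fin 2) (ZMod 5)) =
                  ((tau ^ i : GL (Fin 2) (ZMod 5)) : Matrix (Fin 2) (Fin 2) (ZMod 5)) *
                    ((tau : Matrix (Fin 2) (Fin 2) (ZMod 5)) -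
                      ((tau⁻¹ : GL (Fin 2) (ZMod 5)) : Matrix (Fin 2) (Fin 2) (ZMod 5))) ∨
                ((x * ρ φ * x⁻¹ : GL (Fin 2) (ZMod 5)) : Matrix (Fin 2) (Fin 2) (ZMod 5)) =
                  -(((tau ^ i : GL (Fin 2) (ZMod 5)) : Matrix (Fin 2) (Fin 2) (ZMod 5)) *
                    ((tau : Matrix (Fin 2) (Fin 2) (ZMod 5)) -
                      ((tau⁻¹ : GL (Fin 2) (ZMod 5)) : Matrix (Fin 2) (Fin 2) (ZMod 5)))))) ∧
          (x * ρ φ * x⁻¹ ∉ unitsF5Tau →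
            (((x * ρ φ * x⁻¹) ^ 2 : GL (Fin 2) (ZMod 5)) : Matrix (Fin 2) (Fin 2) (ZMod 5)) =
              (2 : ZMod 5) • (1 : Matrix (Fin 2) (Fin 2) (ZMod 5))) := by
  obtain ⟨v, hv, 𝔓, h𝔓, x, hN, -, hF, -, hwild', -⟩ :=
    exists_conj_of_not_isTamelyRamifiedAbove_three_of_det ρ hdet hwild
  refine ⟨v, hv, 𝔓, h𝔓, x, hN, hwild', fun φ hφ ↦ ?_⟩
  obtain ⟨hφD, hdet3⟩ := hF φ hφ
  refine ⟨hdet3, fun hC ↦ exists_eq_tau_pow_mul_of_mem_unitsF5Tau_of_det_eq_three hC hdet3, fun hC ↦ ?_⟩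
  rw [val_sq_of_mem_normalizer_of_not_mem (hN φ hφD) hC, hdet3]
  norm_num
  decide

end Literature.NumberTheory.Automorphic.BCDT

end
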